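import Literature.Analysis.FluidPDE.LerayEnstrophyMonotone
import Literature.Analysis.FluidPDE.LerayHopfRegularIntervalClassical
import Literature.Analysis.FluidPDE.NSHopfEnergy
import HarnessLib

/-!
# Leray's eventual regularity on `ℝ³`, I: from a good time with small energy × enstrophy a
# Leray–Hopf solution is `H¹`-regular for all later times (Leray 1934 §34; RRS 2016 Thm. 8.1)

Analysis/FluidPDE **proofs file** (theorems only: no definitions, no named facts, no `sorry`);
continuation of `LerayEnstrophyMonotone.lean` (the small energy–enstrophy monotonicity of
classical solutions) at the level of Leray–Hopf weak solutions on `ℝ³ × [0, T)` (strict sense,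
`Literature.Analysis.FluidPDE.IsLerayHopfOn`).

## What is proved

* `exists_const_eWeakGradL2Sq_le_of_regular` — along Leray's local REGULAR solution `V` from a
  divergence-free `w ∈ H¹(ℝ³)` (the package of `LerayLocalRegularH1With`: Leray–Hopf from `w`,
  `C([0,d']; H¹)`, classical on `(0, d']`, all spatial Sobolev norms of `V, ∂ₜV, P` bounded on
  every `[δ, d']`), if `∫‖V(t)‖² ≤ E₀` and `E₀ · a < c₀ν⁴`, `∫⁻|∇w|² ≤ a`, then `∫⁻|∇V(τ)|² ≤ a` on
  `[0, d']` (the monotonicity `exists_enstrophy_le_initial_of_small` on each `[δ, d']`, and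
  `δ → 0⁺` through `H¹`-continuity and the strong attainment of the datum);
* `exists_leray_window` — for a Leray–Hopf weak solution `u` on `ℝ³ × [0, T)` with
  `∫‖u(t)‖² ≤ E₀`, a good restarting time `σ` with `∫⁻|∇u(σ)|² ≤ a`, `E₀ a < c₀ν⁴` and
  `a² d ≤ c ν³`: `u` is `H¹`-regular on `[σ, min(σ + d, T)]` with `∫⁻|∇u|² ≤ a` there (Leray's
  regular solution from `u(σ)` + the proved weak–strong uniqueness
  `serrin_weak_strong_uniqueness_holds`, as in the tree's `isH1RegularOn_Icc_step`, plus the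
  bound above);
* `exists_isH1RegularOn_Icc_of_small_good_time` — **from a good time `s` with
  `(‖u₀‖₂² + 1) · ∫⁻|∇u(s)|² < c₀ν⁴` the solution is `H¹`-regular on `[s, T]`** and keeps
  `∫⁻|∇u(t)|² ≤ ∫⁻|∇u(s)|²`-level bounds: windows of the fixed length `d = cν³/a²` issued from
  good times (dense: `IsLerayHopfOn.exists_isLerayHopfOn_restart_Ioo`) are chained with NO loss
  in `a`, so finitely many reach any horizon. This is the mechanism of Leray 1934 §34 /
  Robinson–Rodrigo–Sadowski 2016 Thm. 8.1 ("any global Leray–Hopf weak solution is eventually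
  strong"); the selection of such a good time from the finite dissipation `∫₀^∞‖∇u‖² ≤ ‖u₀‖²/2ν`
  and the classical representative on `(s, ∞)` are in `LerayEventualRegularity.lean`.

## Mathlib / tree search

Reused (all proved in the tree): `leray_local_regular_H1_holds` (`LerayLocalRegularH1Proofs`),
`serrin_weak_strong_uniqueness_holds`, `memLqLp_top_six_of_isH1RegularOn_Icc`,
`eH1NormSq_congr_ae` / `eWeakGradL2Sq_congr_ae`, `IsH1RegularOn.union_Icc` (`LerayH1Continuation`),
`IsLerayHopfOn.exists_isLerayHopfOn_restart_Ioo` (`CheskidovShvydkoyRegular`),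
`IsClassicalNSSolutionOn.comp_add_right` / `.mono`, `timeDerivWithin_comp_add_right`,
`IsSmoothSpaceTimeOn.timeDerivWithin_eq_of_subset`,
`Torus.tendsto_integral_norm_sq_of_tendsto_eLpNorm_sub` (`NSHopfEnergy`),
`exists_enstrophy_le_initial_of_small` / `exists_enstrophy_dissipative_ineq`
(`LerayEnstrophyMonotone`). `lean search 'eventual'`: only the torus classical form
`Torus.exists_global_classicalNS_of_luDoeringTameTime_le` (`TorusNSSmallDataGlobal`).

## References

* J. Leray, Acta Math. 63 (1934) 193–248, §20, §34. [Leray1934]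
* J. C. Robinson, J. L. Rodrigo, W. Sadowski, *The Three-Dimensional Navier–Stokes Equations*, CUP
  2016, Lemma 6.11, Lemma 6.13, Thm. 6.15, Lemma 8.4, Thm. 8.1. [RobinsonRodrigoSadowski2016]
* W. S. Ożański, B. C. Pooley, *Leray's fundamental work on the Navier–Stokes equations*, in
  LMS Lecture Notes 452 (2018) = arXiv:1708.09787, Thm. 6.30, Cor. 6.16. [OzanskiPooley2018]

WHAT THIS IS NOT: not a claim about NS regularity or blow-up; not a claim about any author beyond
the typed locator.
-/

noncomputable section

open MeasureTheory Set Function Filter Topology InnerProductSpace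
open scoped ENNReal NNReal RealInnerProductSpace

namespace Literature.Analysis.FluidPDE

/-! ### Time translation of Leray's regular package -/

/-- **Translating Leray's regular package to a closed slab.** If `(V, P)` is classical on
`(0, d']` and, on `[δ, d']` (`0 < δ < d'`), `V` and `∂ₜV` (time derivative within `(0, d']`) have
all spatial Sobolev norms bounded and `P` has all spatial Sobolev norms bounded, then the
translate `(V(· + δ), P(· + δ))` is a classical solution on the closed slab `[0, d' − δ]` in the
smooth `H¹` class of `exists_enstrophy_le_initial_of_small` (time derivative within the slab).
Bookkeeping (Fefferman (1)–(2) are autonomous; one-sided derivatives on nested intervals agree).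
[folklore] -/
private theorem package_translate {ν d' δ : ℝ}
    {V : ℝ → EuclideanSpace ℝ (Fin 3) → EuclideanSpace ℝ (Fin 3)}
    {P : ℝ → EuclideanSpace ℝ (Fin 3) → ℝ}
    (hVcl : IsClassicalNSSolutionOn (Ioc 0 d') ν 0 V P) (hδ : 0 < δ) (hδd : δ < d')
    (hsob : HasBoundedSobolevNormsOn (Icc δ d') V)
    (hsobt : HasBoundedSobolevNormsOn (Icc δ d') (timeDerivWithin (Ioc 0 d') V))
    (hP : ∀ n : ℕ, ∃ C : ℝ≥0, ∀ t ∈ Icc δ d', ∫⁻ x, ‖iteratedFDeriv ℝ n (P t) x‖ₑ ^ 2 ≤ C) :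
    IsClassicalNSSolutionOn (Icc 0 (d' - δ)) ν 0 (fun t => V (t + δ)) (fun t => P (t + δ)) ∧
    HasBoundedSobolevNormsOn (Icc 0 (d' - δ)) (fun t => V (t + δ)) ∧
    HasBoundedSobolevNormsOn (Icc 0 (d' - δ))
      (timeDerivWithin (Icc 0 (d' - δ)) (fun t => V (t + δ))) ∧
    ∀ n : ℕ, ∃ C : ℝ≥0, ∀ t ∈ Icc 0 (d' - δ),
      ∫⁻ x, ‖iteratedFDeriv ℝ n (P (t + δ)) x‖ₑ ^ 2 ≤ C := by
  have hsub : Icc δ d' ⊆ Ioc 0 d' := fun t ht => ⟨hδ.trans_le ht.1, ht.2⟩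
  have hU : UniqueDiffOn ℝ (Icc δ d') := uniqueDiffOn_Icc hδd
  have h1 : IsClassicalNSSolutionOn (Icc δ d') ν 0 V P := hVcl.mono hsub hU
  have hpre : (fun t : ℝ => t + δ) ⁻¹' Icc δ d' = Icc 0 (d' - δ) := by
    rw [Set.preimage_add_const_Icc, sub_self]
  have h2 := h1.comp_add_right δ
  rw [hpre] at h2
  have hmem : ∀ t ∈ Icc (0 : ℝ) (d' - δ), t + δ ∈ Icc δ d' := fun t ht =>
    ⟨by linarith [ht.1], by linarith [ht.2]⟩
  refine ⟨h2, fun n => ?_, fun n => ?_, fun n => ?_⟩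
  · obtain ⟨C, hC⟩ := hsob n
    exact ⟨C, fun t ht => hC (t + δ) (hmem t ht)⟩
  · obtain ⟨C, hC⟩ := hsobt n
    refine ⟨C, fun t ht => ?_⟩
    have heq : timeDerivWithin (Icc 0 (d' - δ)) (fun s => V (s + δ)) t =
        timeDerivWithin (Ioc 0 d') V (t + δ) := by
      funext x
      rw [← hpre, timeDerivWithin_comp_add_right,
        hVcl.smooth_velocity.timeDerivWithin_eq_of_subset hsub hU (hmem t ht) x]
    rw [heq]
    exact hC (t + δ) (hmem t ht)
  · obtain ⟨C, hC⟩ := hP n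
    exact ⟨C, fun t ht => hC (t + δ) (hmem t ht)⟩

/-! ### Leray's regular solution from small `H¹` data keeps its enstrophy below the datum's -/

/-- **Enstrophy bound along Leray's local regular solution from small data** (Leray 1934 §20;
Robinson–Rodrigo–Sadowski 2016, Lemma 6.13 with Thm. 6.15 / Ożański–Pooley 2018, Thm. 6.30 and
Cor. 6.16). There is an absolute `c₀ > 0` such that: if `(V, P)` is Leray's regular solution on
`[0, d']` from the divergence-free datum `w ∈ H¹(ℝ³)` — Leray–Hopf from `w`, `V(0) = w`,
`H¹`-regular on `[0, d']`, classical on `(0, d']` with all spatial Sobolev norms of `V`, `∂ₜV`, `P`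
bounded on every `[δ, d']` (the package of `LerayLocalRegularH1With`) — and
`∫ ‖V(t)‖² ≤ E₀` on `[0, d']` with `E₀ · a < c₀ ν⁴` and `∫⁻ |∇w|² ≤ a`, then `∫⁻ |∇V(τ)|² ≤ a` for
every `τ ∈ [0, d']`. Proof: on each `[δ, d']` the translate is in the smooth `H¹` class
(`package_translate`), so `exists_enstrophy_le_initial_of_small` gives `G(τ) ≤ G(δ)` once
`E₀ G(δ) < c₀ν⁴`; and `G(δ) → ∫⁻|∇w|²` as `δ → 0⁺` by `H¹`-continuity at `0` and strong `L²`
attainment of the datum (`tendsto_integral_norm_sq_of_tendsto_eLpNorm_sub`).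
[cite: RobinsonRodrigoSadowski2016, Lemma 6.13 and Thm. 6.15] -/
theorem exists_const_eWeakGradL2Sq_le_of_regular :
    ∃ c₀ : ℝ, 0 < c₀ ∧ ∀ ⦃ν d' : ℝ⦄, 0 < ν → 0 < d' →
      ∀ ⦃V : ℝ → EuclideanSpace ℝ (Fin 3) → EuclideanSpace ℝ (Fin 3)⦄
        ⦃P : ℝ → EuclideanSpace ℝ (Fin 3) → ℝ⦄
        ⦃w : EuclideanSpace ℝ (Fin 3) → EuclideanSpace ℝ (Fin 3)⦄,
        IsLerayHopfOn d' ν 0 w V → V 0 = w → IsH1RegularOn (Icc 0 d') V →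
        IsClassicalNSSolutionOn (Ioc 0 d') ν 0 V P →
        (∀ δ : ℝ, 0 < δ → δ ≤ d' →
          HasBoundedSobolevNormsOn (Icc δ d') V ∧
          HasBoundedSobolevNormsOn (Icc δ d') (timeDerivWithin (Ioc 0 d') V) ∧
          (∀ n : ℕ, ∃ C : ℝ, ∀ t ∈ Icc δ d', ∀ x, ‖iteratedFDeriv ℝ n (V t) x‖ ≤ C) ∧
          (∀ n : ℕ, ∃ C : ℝ≥0, ∀ t ∈ Icc δ d', ∫⁻ x, ‖iteratedFDeriv ℝ n (P t) x‖ₑ ^ 2 ≤ C)) →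
        ∀ ⦃E₀ a : ℝ⦄, 0 < E₀ → (∀ t ∈ Icc 0 d', ∫ x, ‖V t x‖ ^ 2 ≤ E₀) → 0 ≤ a →
          E₀ * a < c₀ * ν ^ 4 → eWeakGradL2Sq w ≤ ENNReal.ofReal a →
          ∀ τ ∈ Icc 0 d', eWeakGradL2Sq (V τ) ≤ ENNReal.ofReal a := by
  obtain ⟨c₀, hc₀, hmono⟩ := exists_enstrophy_le_initial_of_small
  obtain ⟨κ, -, hdis⟩ := exists_enstrophy_dissipative_ineq
  refine ⟨c₀, hc₀, ?_⟩
  intro ν d' hν hd' V P w hV hV0 hVreg hVcl hVpack E₀ a hE₀ hE ha hsmall hgradw τ hτ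
  rcases eq_or_lt_of_le hτ.1 with h0 | hτ0
  · rw [← h0, hV0]; exact hgradw
  -- the real enstrophy of the classical slices
  obtain ⟨g, hg⟩ : ∃ g : ℝ → ℝ, g = fun t => ∫ x, frobeniusNormSq (fderiv ℝ (V t) x) := ⟨_, rfl⟩
  have hgt : ∀ t, g t = ∫ x, frobeniusNormSq (fderiv ℝ (V t) x) := fun t => by rw [hg]
  -- (A) on `[δ, d']`: monotonicity under smallness at `δ`, and `∫⁻|∇V(t)|² = ofReal (g t)`
  have hA : ∀ δ ∈ Ioo 0 d', (E₀ * g δ < c₀ * ν ^ 4 → ∀ t ∈ Icc δ d', g t ≤ g δ) ∧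
      ∀ t ∈ Icc δ d', eWeakGradL2Sq (V t) = ENNReal.ofReal (g t) := by
    intro δ hδ
    obtain ⟨hs1, hs2, -, hs4⟩ := hVpack δ hδ.1 hδ.2.le
    obtain ⟨hWcl, hWsob, hWt, hWP⟩ := package_translate hVcl hδ.1 hδ.2 hs1 hs2 hs4
    have hL : 0 < d' - δ := sub_pos.2 hδ.2
    have hEW : ∀ t ∈ Icc 0 (d' - δ), ∫ x, ‖V (t + δ) x‖ ^ 2 ≤ E₀ := fun t ht =>
      hE (t + δ) ⟨by linarith [ht.1, hδ.1], by linarith [ht.2]⟩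
    obtain ⟨-, -, -, -, -, hGeq⟩ := hdis hν hL hWcl hWsob hWt hWP
    constructor
    · intro hsm t ht
      have hsm' : E₀ * ∫ x, frobeniusNormSq (fderiv ℝ (V (0 + δ)) x) < c₀ * ν ^ 4 := by
        rw [zero_add, ← hgt]; exact hsm
      have h := hmono hν hL hWcl hWsob hWt hWP hE₀ hEW hsm' (t - δ)
        ⟨by linarith [ht.1], by linarith [ht.2]⟩
      rw [zero_add, sub_add_cancel, ← hgt, ← hgt] at h
      exact h
    · intro t ht
      have htI : t - δ ∈ Icc 0 (d' - δ) := ⟨by linarith [ht.1], by linarith [ht.2]⟩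
      have h1 := hGeq (t - δ) htI
      simp only [sub_add_cancel] at h1
      have hC1 : ContDiff ℝ 1 (V t) :=
        (hVcl.contDiff_velocity ⟨hδ.1.trans_le ht.1, ht.2⟩).of_le (by norm_cast)
      rw [eWeakGradL2Sq_eq_of_hasWeakGradient (hasWeakGradient_fderiv_of_contDiff hC1), hgt, ← h1]
  -- (B) `g(δ) → ∫⁻|∇w|²` as `δ → 0⁺`
  have hw2 : MemLp w 2 volume := by
    have h := hV.memLp 0 ⟨le_rfl, hd'.le⟩
    rwa [hV0] at h
  have hγtop : eWeakGradL2Sq w ≠ ⊤ := (hgradw.trans_lt ENNReal.ofReal_lt_top).ne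
  set γ : ℝ := (eWeakGradL2Sq w).toReal with hγ
  have hγa : γ ≤ a := ENNReal.toReal_le_of_le_ofReal ha hgradw
  obtain ⟨e, he⟩ : ∃ e : ℝ → ℝ, e = fun t => ∫ x, ‖V t x‖ ^ 2 := ⟨_, rfl⟩
  have het : ∀ t, e t = ∫ x, ‖V t x‖ ^ 2 := fun t => by rw [he]
  set e₀ : ℝ := ∫ x, ‖w x‖ ^ 2 with he₀
  -- energy continuity at `0⁺` from the strong attainment of the datum
  have he_tend : Tendsto e (𝓝[>] 0) (𝓝 e₀) := by
    classical
    set V' : ℝ → EuclideanSpace ℝ (Fin 3) → EuclideanSpace ℝ (Fin 3) :=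
      fun t => if t ∈ Icc 0 d' then V t else w with hV'
    have hV'2 : ∀ t, MemLp (V' t) 2 volume := by
      intro t
      by_cases ht : t ∈ Icc 0 d'
      · simp only [hV', ht, if_true]; exact hV.memLp t ht
      · simp only [hV', ht, if_false]; exact hw2
    have hmem : ∀ᶠ t in 𝓝[>] (0 : ℝ), t ∈ Ioo 0 d' := Ioo_mem_nhdsGT hd'
    have heqV : ∀ᶠ t in 𝓝[>] (0 : ℝ), V' t = V t := by
      filter_upwards [hmem] with t ht
      simp only [hV', Ioo_subset_Icc_self ht, if_true]
    have hstrong : Tendsto (fun t => eLpNorm (V' t - w) 2 volume) (𝓝[>] 0) (𝓝 0) := by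
      have h := hV.strong_initial
      refine h.congr' ?_
      filter_upwards [heqV] with t ht
      rw [ht]
    have h := Torus.tendsto_integral_norm_sq_of_tendsto_eLpNorm_sub hV'2 hw2 hstrong
    refine h.congr' ?_
    filter_upwards [heqV] with t ht
    rw [ht, het]
  -- `H¹`-continuity at `0`, in real form on `(0, d')`
  have hfin0 : eH1NormSq w ≠ ⊤ := by
    have h := hVreg.1 0 ⟨le_rfl, hd'.le⟩
    rw [hV0] at h
    exact h.ne
  have hH : Tendsto (fun t => (eH1NormSq (V t)).toReal) (𝓝[>] 0) (𝓝 (eH1NormSq w).toReal) := by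
    have hc : ContinuousWithinAt (fun t => eH1NormSq (V t)) (Icc 0 d') 0 :=
      hVreg.2 0 ⟨le_rfl, hd'.le⟩
    have h1 : Tendsto (fun t => eH1NormSq (V t)) (𝓝[Icc 0 d'] 0) (𝓝 (eH1NormSq w)) := by
      have := hc.tendsto
      rwa [hV0] at this
    have h2 : Tendsto (fun t => eH1NormSq (V t)) (𝓝[>] 0) (𝓝 (eH1NormSq w)) := by
      rw [← nhdsWithin_Ioo_eq_nhdsGT hd']
      exact h1.mono_left (nhdsWithin_mono _ Ioo_subset_Icc_self)
    exact (ENNReal.tendsto_toReal hfin0).comp h2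
  have hEq_t : ∀ t ∈ Ioo 0 d', (eH1NormSq (V t)).toReal = e t + g t := by
    intro t ht
    have hEn : eEnergy (V t) = ENNReal.ofReal (e t) := by
      rw [eEnergy_eq_ofReal _ (hV.memLp t (Ioo_subset_Icc_self ht)), VectorCalculus.kineticEnergy,
        ← mul_assoc, mul_inv_cancel₀ two_ne_zero, one_mul, het]
    have hGr : eWeakGradL2Sq (V t) = ENNReal.ofReal (g t) := (hA t ht).2 t ⟨le_rfl, ht.2.le⟩
    have he0 : 0 ≤ e t := by rw [het]; exact integral_nonneg fun _ => sq_nonneg _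
    have hg0 : 0 ≤ g t := by rw [hgt]; exact integral_nonneg fun _ => frobeniusNormSq_nonneg _
    rw [eH1NormSq_def, hEn, hGr, ENNReal.toReal_add ENNReal.ofReal_ne_top ENNReal.ofReal_ne_top,
      ENNReal.toReal_ofReal he0, ENNReal.toReal_ofReal hg0]
  have hEq_0 : (eH1NormSq w).toReal = e₀ + γ := by
    have hEn : eEnergy w = ENNReal.ofReal e₀ := by
      rw [eEnergy_eq_ofReal _ hw2, VectorCalculus.kineticEnergy, ← mul_assoc,
        mul_inv_cancel₀ two_ne_zero, one_mul]
    have he0 : 0 ≤ e₀ := integral_nonneg fun _ => sq_nonneg _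
    rw [eH1NormSq_def, hEn, ENNReal.toReal_add ENNReal.ofReal_ne_top hγtop,
      ENNReal.toReal_ofReal he0]
  have hsum : Tendsto (fun t => e t + g t) (𝓝[>] 0) (𝓝 (e₀ + γ)) := by
    rw [← hEq_0]
    refine hH.congr' ?_
    filter_upwards [Ioo_mem_nhdsGT hd'] with t ht
    exact hEq_t t ht
  have hg_tend : Tendsto g (𝓝[>] 0) (𝓝 γ) := by
    have h := hsum.sub he_tend
    rw [add_sub_cancel_left] at h
    refine h.congr' (Eventually.of_forall fun t => ?_)
    show e t + g t - e t = g t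
    ring
  -- (C) pass to the limit `δ → 0⁺` in `g τ ≤ g δ`
  have hlt : E₀ * γ < c₀ * ν ^ 4 := lt_of_le_of_lt (mul_le_mul_of_nonneg_left hγa hE₀.le) hsmall
  have hev_small : ∀ᶠ δ in 𝓝[>] (0 : ℝ), E₀ * g δ < c₀ * ν ^ 4 :=
    (hg_tend.const_mul E₀).eventually (gt_mem_nhds hlt)
  have hev : ∀ᶠ δ in 𝓝[>] (0 : ℝ), g τ ≤ g δ := by
    filter_upwards [hev_small, Ioo_mem_nhdsGT hτ0] with δ hsm hδ
    exact (hA δ ⟨hδ.1, hδ.2.trans_le hτ.2⟩).1 hsm τ ⟨hδ.2.le, hτ.2⟩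
  have hle : g τ ≤ γ := ge_of_tendsto hg_tend hev
  have hτ2 : τ / 2 ∈ Ioo 0 d' := ⟨by linarith, by linarith [hτ.2]⟩
  rw [(hA (τ / 2) hτ2).2 τ ⟨by linarith, hτ.2⟩]
  exact ENNReal.ofReal_le_ofReal (hle.trans hγa)

/-! ### One window: `H¹`-regularity and the enstrophy bound persist for a fixed time -/

/-- **Leray's window from a good small time** (Robinson–Rodrigo–Sadowski 2016, proof of
Lemma 6.11 / Lemma 8.4 — restart at a good time and weak–strong uniqueness — combined with
Lemma 6.13). There are absolute `c, c₀ > 0` such that: if `u` is a Leray–Hopf weak solution on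
`ℝ³ × [0, T)` with `∫ ‖u(t)‖² ≤ E₀` on `[0, T]`, `σ ∈ (0, T)` is a good restarting time
(`u(· + σ)` Leray–Hopf from `u(σ)`), `∫⁻ |∇u(σ)|² ≤ a` with `E₀ · a < c₀ ν⁴`, and `a² d ≤ c ν³`,
then
`u` is `H¹`-regular on `[σ, min(σ + d, T)]` and `∫⁻ |∇u(t)|² ≤ a` there. Proof: Leray's regular
solution `V` from `u(σ)` on `[0, min(d, T − σ)]` (`leray_local_regular_H1_holds`) coincides with
`u(σ + ·)` slice-wise a.e. by `serrin_weak_strong_uniqueness_holds` (`V ∈ L^∞_t L⁶_x`), and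
`exists_const_eWeakGradL2Sq_le_of_regular` bounds its enstrophy by `a`.
[cite: RobinsonRodrigoSadowski2016, Lemma 6.11 (proof), Lemma 6.13, Lemma 8.4] -/
theorem exists_leray_window :
    ∃ c c₀ : ℝ, 0 < c ∧ 0 < c₀ ∧
      ∀ ⦃ν T : ℝ⦄ ⦃u₀ : EuclideanSpace ℝ (Fin 3) → EuclideanSpace ℝ (Fin 3)⦄
      ⦃u : ℝ → EuclideanSpace ℝ (Fin 3) → EuclideanSpace ℝ (Fin 3)⦄, 0 < ν →
      IsLerayHopfOn T ν 0 u₀ u → ∀ ⦃σ : ℝ⦄, σ ∈ Ioo 0 T →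
      IsLerayHopfOn (T - σ) ν 0 (u σ) (fun t => u (t + σ)) →
      ∀ ⦃E₀ a d : ℝ⦄, 0 < E₀ → (∀ t ∈ Icc 0 T, ∫ x, ‖u t x‖ ^ 2 ≤ E₀) → 0 < a →
        E₀ * a < c₀ * ν ^ 4 → 0 < d → a ^ 2 * d ≤ c * ν ^ 3 →
        eWeakGradL2Sq (u σ) ≤ ENNReal.ofReal a →
        IsH1RegularOn (Icc σ (min (σ + d) T)) u ∧
          ∀ t ∈ Icc σ (min (σ + d) T), eWeakGradL2Sq (u t) ≤ ENNReal.ofReal a := by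
  obtain ⟨c, hc, hpack⟩ := leray_local_regular_H1_holds
  obtain ⟨c₀, hc₀, hgrad⟩ := exists_const_eWeakGradL2Sq_le_of_regular
  refine ⟨c, c₀, hc, hc₀, ?_⟩
  intro ν T u₀ u hν hLH σ hσ hLHσ E₀ a d hE₀ hE ha hsmall hd hdc hgσ
  set d' : ℝ := min d (T - σ) with hd'def
  have hd' : 0 < d' := lt_min hd (sub_pos.2 hσ.2)
  have hd'c : a ^ 2 * d' ≤ c * ν ^ 3 :=
    (mul_le_mul_of_nonneg_left (min_le_left _ _) (sq_nonneg a)).trans hdc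
  have hu2 : MemLp (u σ) 2 volume := hLH.memLp σ ⟨hσ.1.le, hσ.2.le⟩
  have hdiv : IsWeaklyDivFree (u σ) := hLHσ.isWeaklyDivFree_datum (sub_pos.2 hσ.2)
  obtain ⟨V, P, hV, hV0, hVreg, hVcl, hVpack⟩ := hpack hν hd' hu2 hdiv ha.le hgσ hd'c
  -- weak–strong uniqueness: `u(t + σ) = V(t)` a.e., `0 < t ≤ d'`
  have hLHσ' : IsLerayHopfOn d' ν 0 (u σ) (fun t => u (t + σ)) := hLHσ.of_le (min_le_right _ _)
  have hS : MemLqLp ∞ 6 V (Ioo 0 d') :=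
    memLqLp_top_six_of_isH1RegularOn_Icc hVreg fun t ht => hV.memLp t ht
  have hqr : 2 / (∞ : ℝ≥0∞) + 3 / 6 ≤ 1 := by
    rw [ENNReal.div_top, zero_add]
    exact ENNReal.div_le_of_le_mul (by norm_num)
  have hWS : serrin_weak_strong_uniqueness := serrin_weak_strong_uniqueness_holds
  have hae : ∀ t ∈ Ioc 0 d', (fun t => u (t + σ)) t =ᵐ[volume] V t :=
    hWS hν hd' hV hu2 (q := ∞) (r := 6) (by norm_num) hqr hS hLHσ'
  -- the energy bound along `V`
  have hEV : ∀ t ∈ Icc 0 d', ∫ x, ‖V t x‖ ^ 2 ≤ E₀ := by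
    intro t ht
    have htσ : t + σ ∈ Icc 0 T :=
      ⟨by linarith [ht.1, hσ.1], by linarith [ht.2, min_le_right d (T - σ)]⟩
    rcases eq_or_lt_of_le ht.1 with h0 | h0
    · rw [← h0, hV0]; exact hE σ ⟨hσ.1.le, hσ.2.le⟩
    · have h1 : (fun x => ‖V t x‖ ^ 2) =ᵐ[volume] fun x => ‖u (t + σ) x‖ ^ 2 := by
        filter_upwards [hae t ⟨h0, ht.2⟩] with x hx
        rw [← hx]
      rw [integral_congr_ae h1]
      exact hE (t + σ) htσ
  -- the enstrophy bound along `V`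
  have hgradV : ∀ τ ∈ Icc 0 d', eWeakGradL2Sq (V τ) ≤ ENNReal.ofReal a :=
    hgrad hν hd' hV hV0 hVreg hVcl hVpack hE₀ hEV ha.le hsmall hgσ
  -- transfer to `u` on `[σ, σ + d']`
  have heq : ∀ t ∈ Icc σ (σ + d'), eH1NormSq (u t) = eH1NormSq (V (t - σ)) ∧
      eWeakGradL2Sq (u t) = eWeakGradL2Sq (V (t - σ)) := by
    intro t ht
    rcases eq_or_lt_of_le ht.1 with h | h
    · rw [← h, sub_self, hV0]; exact ⟨rfl, rfl⟩
    · have h1 := hae (t - σ) ⟨sub_pos.2 h, by linarith [ht.2]⟩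
      simp only [sub_add_cancel] at h1
      exact ⟨eH1NormSq_congr_ae h1, eWeakGradL2Sq_congr_ae h1⟩
  have hmin : min (σ + d) T = σ + d' := by
    rw [hd'def, ← min_add_add_left, add_sub_cancel]
  have hmaps : MapsTo (fun t => t - σ) (Icc σ (σ + d')) (Icc 0 d') := fun t ht =>
    ⟨sub_nonneg.2 ht.1, by linarith [ht.2]⟩
  rw [hmin]
  refine ⟨⟨fun t ht => ?_, ?_⟩, fun t ht => ?_⟩
  · rw [(heq t ht).1]
    exact hVreg.1 (t - σ) (hmaps ht)
  · have hcont : ContinuousOn (fun t => eH1NormSq (V (t - σ))) (Icc σ (σ + d')) :=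
      hVreg.2.comp (continuousOn_id.sub continuousOn_const) hmaps
    exact hcont.congr fun t ht => (heq t ht).1
  · rw [(heq t ht).2]
    exact hgradV (t - σ) (hmaps ht)

/-! ### From a good small time the solution is `H¹`-regular up to the horizon -/

/-- **Global `H¹`-regularity after a good time with small energy × enstrophy** (Leray 1934,
§34; Robinson–Rodrigo–Sadowski 2016, Thm. 8.1 with Lemma 6.13). There is an absolute `c₀ > 0`
such that: if `u` is a Leray–Hopf weak solution of the unforced system on `ℝ³ × [0, T)` from
`u₀`, `s ∈ (0, T)` is a good restarting time, and `∫⁻ |∇u(s)|² ≤ a` with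
`(‖u₀‖₂² + 1) · a < c₀ ν⁴`, then `‖u(t)‖²_{H¹}` is finite and continuous on `[s, T]` and
`∫⁻ |∇u(t)|² ≤ a` for every `t ∈ [s, T]`. Proof: the energy inequality gives
`‖u(t)‖₂² ≤ ‖u₀‖₂²`; with `d = cν³/a²` the windows of `exists_leray_window` issued from good times
(which are dense, `IsLerayHopfOn.exists_isLerayHopfOn_restart_Ioo`) carry both the regularity
and the bound `∫⁻|∇u|² ≤ a` forward by `d/2` at each step, with no loss, until `T`.
[cite: RobinsonRodrigoSadowski2016, Thm. 8.1 (proof)] -/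
theorem exists_isH1RegularOn_Icc_of_small_good_time :
    ∃ c₀ : ℝ, 0 < c₀ ∧ ∀ ⦃ν T : ℝ⦄ ⦃u₀ : EuclideanSpace ℝ (Fin 3) → EuclideanSpace ℝ (Fin 3)⦄
      ⦃u : ℝ → EuclideanSpace ℝ (Fin 3) → EuclideanSpace ℝ (Fin 3)⦄, 0 < ν →
      IsLerayHopfOn T ν 0 u₀ u → ∀ ⦃s : ℝ⦄, s ∈ Ioo 0 T →
      IsLerayHopfOn (T - s) ν 0 (u s) (fun t => u (t + s)) → ∀ ⦃a : ℝ⦄, 0 < a →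
      (2 * VectorCalculus.kineticEnergy u₀ + 1) * a < c₀ * ν ^ 4 →
      eWeakGradL2Sq (u s) ≤ ENNReal.ofReal a →
      IsH1RegularOn (Icc s T) u ∧ ∀ t ∈ Icc s T, eWeakGradL2Sq (u t) ≤ ENNReal.ofReal a := by
  obtain ⟨c, c₀, hc, hc₀, hwin⟩ := exists_leray_window
  refine ⟨c₀, hc₀, ?_⟩
  intro ν T u₀ u hν hLH s hs hLHs a ha hsmall hgs
  set E₀ : ℝ := 2 * VectorCalculus.kineticEnergy u₀ + 1 with hE₀def
  have hE₀ : 0 < E₀ := by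
    have := kineticEnergy_nonneg u₀
    rw [hE₀def]; linarith
  -- the energy inequality: `∫ ‖u(t)‖² ≤ 2 KE(u₀) < E₀`
  have hE : ∀ t ∈ Icc 0 T, ∫ x, ‖u t x‖ ^ 2 ≤ E₀ := by
    obtain ⟨G, -, h0⟩ := hLH.energy_ineq_zero
    intro t ht
    have h1 := h0 t ht
    have hforce :
        ∫ τ in (0 : ℝ)..t, ∫ x, ⟪(0 : ℝ → EuclideanSpace ℝ (Fin 3) → EuclideanSpace ℝ (Fin 3)) τ x,
          u τ x⟫ = 0 := by
      simp
    rw [hforce, add_zero] at h1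
    have h2 : 0 ≤ ν * (∫⁻ τ in Ioo 0 t, ∫⁻ x, ENNReal.ofReal (frobeniusNormSq (G τ x))).toReal :=
      mul_nonneg hν.le ENNReal.toReal_nonneg
    have h3 : ∫ x, ‖u t x‖ ^ 2 = 2 * VectorCalculus.kineticEnergy (u t) := by
      rw [VectorCalculus.kineticEnergy, ← mul_assoc, mul_inv_cancel₀ two_ne_zero, one_mul]
    rw [h3, hE₀def]
    linarith
  -- the lifespan `d = c ν³ / a²`
  set d : ℝ := c * ν ^ 3 / a ^ 2 with hddef
  have hd : 0 < d := by positivity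
  have hdc : a ^ 2 * d ≤ c * ν ^ 3 := by
    rw [hddef, mul_div_cancel₀ _ (by positivity : a ^ 2 ≠ 0)]
  -- induction over windows of length `d/2`
  have key : ∀ n : ℕ, IsH1RegularOn (Icc s (min (s + (n + 2) * (d / 2)) T)) u ∧
      ∀ t ∈ Icc s (min (s + (n + 2) * (d / 2)) T), eWeakGradL2Sq (u t) ≤ ENNReal.ofReal a := by
    intro n
    induction n with
    | zero =>
      have h := hwin hν hLH hs hLHs hE₀ hE ha hsmall hd hdc hgs
      have h2 : s + (0 + 2) * (d / 2) = s + d := by ring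
      simp only [Nat.cast_zero, h2]
      exact h
    | succ n ih =>
      obtain ⟨ihreg, ihbd⟩ := ih
      set b : ℝ := s + (n + 2) * (d / 2) with hbdef
      have hb' : s + ((n + 1 : ℕ) + 2) * (d / 2) = b + d / 2 := by
        rw [hbdef]; push_cast; ring
      rw [hb']
      by_cases hbT : T ≤ b
      · -- the interval is already `[s, T]`
        have h1 : min b T = T := min_eq_right hbT
        have h2 : min (b + d / 2) T = T := min_eq_right (by linarith)
        rw [h1] at ihreg ihbd
        rw [h2]
        exact ⟨ihreg, ihbd⟩
      · rw [not_le] at hbT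
        have h1 : min b T = b := min_eq_left hbT.le
        rw [h1] at ihreg ihbd
        have hsb : s + d ≤ b := by
          rw [hbdef]
          have : (0 : ℝ) ≤ n := n.cast_nonneg
          nlinarith
        -- a good time `σ ∈ (b - d/4, b)`
        have hl0 : 0 ≤ b - d / 4 := by linarith [hs.1]
        obtain ⟨σ, hσI, hLHσ⟩ := hLH.exists_isLerayHopfOn_restart_Ioo hν.le hl0 (by linarith) hbT.le
        have hσs : s ≤ σ := by linarith [hσI.1]
        have hσ : σ ∈ Ioo 0 T := ⟨hs.1.trans_le hσs, hσI.2.trans hbT⟩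
        have hgσ : eWeakGradL2Sq (u σ) ≤ ENNReal.ofReal a := ihbd σ ⟨hσs, hσI.2.le⟩
        obtain ⟨hwreg, hwbd⟩ := hwin hν hLH hσ hLHσ hE₀ hE ha hsmall hd hdc hgσ
        -- paste `[s, b]` and `[σ, min (σ + d) T]`
        have hsub : Icc s (min (b + d / 2) T) ⊆ Icc s b ∪ Icc σ (min (σ + d) T) := by
          intro t ht
          rcases le_or_gt t b with htb | htb
          · exact Or.inl ⟨ht.1, htb⟩
          · refine Or.inr ⟨hσI.2.le.trans htb.le, ?_⟩
            have : min (b + d / 2) T ≤ min (σ + d) T :=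
              min_le_min (by linarith [hσI.1]) le_rfl
            exact ht.2.trans this
        refine ⟨(ihreg.union_Icc hwreg).mono hsub, fun t ht => ?_⟩
        rcases hsub ht with h | h
        · exact ihbd t h
        · exact hwbd t h
  -- choose `n` with `s + (n + 2) d/2 ≥ T`
  obtain ⟨n, hn⟩ := exists_nat_gt ((T - s) / (d / 2))
  have hnT : T ≤ s + (n + 2) * (d / 2) := by
    have hd2 : 0 < d / 2 := by positivity
    have h1 : T - s < n * (d / 2) := by
      rw [div_lt_iff₀ hd2] at hn; linarith
    nlinarith
  have hmin : min (s + (n + 2) * (d / 2)) T = T := min_eq_right hnT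
  have h := key n
  rw [hmin] at h
  exact h

end Literature.Analysis.FluidPDE
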